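import Summits.QuantumFields.YangMills.Theorems.BalabanUVNodesN07ShearLetterOfFine
import Summits.QuantumFields.YangMills.Theorems.BalabanUVNodesN07TildeTowerLettersAtDatum
import HarnessLib

/-!
# N07 [B11] (= [15] = [Balaban1985Variational]) Sect. F, road of record R0′, WIDTH-209 row (r2), FILE 19: **THE ς-DOOR AT A TOKEN DATUM** — FILE 18's door at the print datum
# `a := cornerP Mc ρ idx`, `M := sideP Mc ρ` with the fine-regularity hypothesis DISCHARGED from the token's (17) clause ONE LEVEL DOWN ([15] p. 300 «`□̃ ⊂ 𝔅_{j−1}`»,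
# dag-n07-w6 g2 p642198 `mem_omegaPlaqsTop_pred_of_mem_tildeTowerWide_zero`, `α₀ := L²ε`)

Cell `pub-ymgap`, width seat `pub-ymgap-dag-n07-w8` g6, WIDTH-209 N07 row (r2) of road R0′, CLAIM-19 ∕ INTENT-19 (cell bus; own lineage FILE 18 → FILE 19; dag-n07-w6 g2's
`N07TildeTowerLettersAtDatum` CONSUMED BY NAME on their explicit invitation).  `--kind proof --supports stmt-QuantumFields-27364 --as helper` (K1⁹ per dag-lead KEY MAP v2); count-neutral;
def-free.  [15] = [Balaban1985Variational] (17) p. 279, (144)–(145) pp. 300–301, (150)–(152) p. 301, (157)–(159) pp. 302–303, (164)–(165) p. 304, (168) p. 304; [6] = [Balaban1985RegularSpaces]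
p. 98, Lemma 1 (1.25) p. 79; [B7] = [Balaban1985Averaging] Prop. 2 p. 22; [4] = [Balaban1984PropagatorsII] (2.1)–(2.4) p. 224, Cor. 2.8 p. 249.

THE POINT.  FILE 18 displays ONE fine-regularity hypothesis `PlaqSmallOn {q | q.src ∈ □̃_wide} (α₀η_{K−n}²) U`.  At a token datum — print's separated sequence `s` (`Sect2.SeqSeparated M₁ s`),
grid cube `(Mc, idx)` of level `K − n` meeting `Ω_{K−n}` within `Dw`, floor `L·(Mc + 11d + 4ρ + 2(L + R)) + Dw ≤ M₁` (`R = (d+4)L + 2`) — the widened fine `□̃` lies in the (17)-region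
`Sect2.omegaPlaqsTop s.Ω (hullD P M₁ 1 (s.Ω 1)) (K−n−1)` (p642198 §2), so the token's (17) clause at level `K − n − 1` with letter `ε·η_{K−n−1}² = L²ε·η_{K−n}²` IS that hypothesis
with `α₀ := L²ε`.  THIS FILE makes the substitution (p642198's `…_at_datum` h52-bullet, line by line): the shear row of (r2) at a datum then displays ONLY `ε` (+ the two ranges at `L²ε`),
the radial WLOG `hax`, the top letter `v_k`, S3's `t` on `□′` and on `□̃`, the datum binders the knit already holds, and `2d(M′+4ρ+1)(4κL²ε + v_k + 2t) ≤ ½`.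

WHAT IS PROVED (sorry-free; no definition; axioms standard).  ★★★★ `localGaugeSplitOn_of_gauge152_recordShearTildeTower_at_datum_cubeDomains_box F N`.
HONEST SCOPE.  Count-neutral by-name composition of LANDED theorems (FILE 18; dag-n07-w6 g2 p642198 `mem_omegaPlaqsTop_pred_of_mem_tildeTowerWide_zero`, `mul_eta_pred_sq`); hypotheses as listed;
nothing of [15]∕[6]∕[B7]∕[4] ANALYSIS asserted beyond the landed ports; joint satisfiability with the head's budget NOT claimed; HCHART ∕ `LocalLettersSplitTopStepCore(G∕R)` ∕
`DatumGaugeSplitTopStepCore(G∕R)` ∕ `HalvingStepTop(Core)` ∕ `stub_prop8StepCoP13` NOT discharged; K0⁷ ∕ K1⁹ NOT closed; N07 NOT discharged; counts unmoved (typed 28∕28 · discharged 5∕27); one finite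
𝕋⁴ programme at fixed ε — the route closes the conditional finite-𝕋⁴ rung `BalabanLadder.UV` ONLY; the YM mass gap (Clay) is NOT proved by any of this; nothing continuum ∕ ℝ⁴ ∕ OS.
No `sorry`, no `def`, no `instance`, no `notation`.

RELATED IN THE TREE, NOT DUPLICATED (stem check 2026-08-28T14:55Z: `ls …/Theorems | rg -i 'ShearLetterAtDatum|LetterAtDatum'` = ∅): FILE 18 (CONSUMED); dag-n07-w6 g2 `N07TildeTowerLettersAtDatum`
(`dist1_iter_le_down_the_radialRep_levelBoxes_at_datum` = the `v`-clause at the same datum — the OTHER half of the head's data; its §1–§2 geometry CONSUMED).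
-/

set_option autoImplicit false

noncomputable section
open scoped BigOperators Matrix.Norms.L2Operator

namespace Summit.QuantumFields.YangMills.BalabanUVNodes.N07ShearLetterAtDatum

open Literature.MathematicalPhysics.QuantumFieldTheory.Balaban1983to89
open Literature.MathematicalPhysics.QuantumFieldTheory.Balaban1983to89.Node00
open Literature.MathematicalPhysics.QuantumFieldTheory.Balaban1983to89.B12RegularSpaces111 (gaugeU expI grad)
open B15Eq112TorusCover (cover)
open B14DomainGeom (Pt Within)
open B14.Eq213MaximalDomains (side cubeExt)
open B8Eq131Cubes (gs sqLo sqHi tLo tHi box cube)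
open B8Ineq130 (tlo thi)
open B6SectAOperatorsV1 (BondIdx)
open T4Continuum (T4Family)
open T4AxialGaugeSmallField (castSite)
open B16Sect1Backgrounds (toMS)
open GaugeField (gaugeAct)
open MatrixLog (mlog)
open ExpMeanLog (deltaSU)
open Summit.QuantumFields.Balaban3D.Carriers (radialContourData)
open Summit.QuantumFields.YangMills.Theorems.K0FlatCubeOpsTextP (flatH)
open Summit.QuantumFields.YangMills.BalabanUVNodes.N07HalvingStepTopOfLocalLetters (Letters10On)
open Summit.QuantumFields.YangMills.BalabanUVNodes.N07LocalLettersSplitCore (LocalGaugeSplitOn)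
open Summit.QuantumFields.YangMills.BalabanUVNodes.N07ShearLetterOfFine (localGaugeSplitOn_of_gauge152_recordShearTildeTower_of_fine_cubeDomains_box)
open Summit.QuantumFields.YangMills.BalabanUVNodes.N07TildeTowerLettersAtDatum (mem_omegaPlaqsTop_pred_of_mem_tildeTowerWide_zero mul_eta_pred_sq)

open scoped Classical in
/-- ★★★★ **THE ς-DOOR AT A TOKEN DATUM** (FILE 18 ∘ dag-n07-w6 g2 p642198): statement = FILE 18's at `a := cornerP Mc ρ idx`, `M := sideP Mc ρ`, `α₀ := L²ε`, with the fine-regularity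
hypothesis REPLACED by the datum binders (`1 ≤ M₁`, the separated sequence, `K − n ≤` its length, the floor, the meet witness) and the (17) clause `PlaqSmallOn (omegaPlaqsTop s.Ω (hullD P M₁ 1 (s.Ω 1)) (K−n−1)) (ε·η_{K−n−1}²) U`.
[cite: Balaban1985Variational, (17) p.279, (144)–(145) pp.300–301, (150)–(152) p.301, (157)–(159) pp.302–303, (164)–(165) p.304, (168) p.304; Balaban1985RegularSpaces, p.98, Lemma 1 (1.25) p.79; Balaban1985Averaging, Prop. 2 p.22; Balaban1984PropagatorsII, (2.1)–(2.4) p.224, Cor. 2.8 (2.150)–(2.151) p.249] -/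
theorem localGaugeSplitOn_of_gauge152_recordShearTildeTower_at_datum_cubeDomains_box (F : T4Family) (N : ℕ) [NeZero N] :
    ∃ (Mh₀ R₀ : ℕ) (C δ₀ δ₁ B₃ : ℝ), 0 ≤ C ∧ 0 < δ₀ ∧ 0 < δ₁ ∧ 0 < B₃ ∧
    ∀ (n K : ℕ) (_ : 1 ≤ K - n) (_ : K - n + 1 ≤ F.m + K) (hk : K - n ≤ (F.P K).m + (F.P K).K)
      {Mh R a' : ℕ} (_ : Mh = F.L ^ a') (_ : Mh₀ ≤ Mh) (_ : R₀ ≤ R) (_ : a' + 3 ≤ F.m + n)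
      -- ★ the token datum: print's separated sequence, the grid cube `(Mc, idx)` of level `K − n` with its meet witness, the floor, the collar `ρ`
      {Dfam : ℕ → Set (Set (Site (F.P K) 0))} {kS M₁ : ℕ} (_ : 1 ≤ M₁) (s : B14.Eq218Concrete.Seq Dfam kS) (_ : Sect2.SeqSeparated M₁ s) (_ : K - n ≤ kS)
      {Mc ρ Dw : ℕ} (_ : (F.P K).L * (Mc + 11 * (F.P K).d + 4 * ρ + 2 * ((F.P K).L + (((F.P K).d + 4) * (F.P K).L + 2))) + Dw ≤ M₁)
      {idx : Pt (F.P K).d} (_ : ∃ x y : Pt (F.P K).d, x ∈ cubeExt (side (F.P K).L Mc (K - n)) idx 0 ∧ cover (F.P K) y ∈ s.Ω (K - n) ∧ Within (Dw : ℤ) x y)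
      (_ : F.L * Mh ∣ ρ) (_ : ∀ i, ((F.L * Mh : ℕ) : ℤ) ∣ (cornerP (F.P K) Mc ρ idx) i) (_ : F.L * Mh ∣ (sideP (F.P K) Mc ρ)) (_ : F.L * Mh ∣ (F.P K).sitesPerDir (K - n)) (_ : R * (F.L * Mh) ≤ ρ)
      (_ : F.L ≤ ρ) (_ : Set.InjOn (cover (F.P K)) (cube (F.P K).L (cornerP (F.P K) Mc ρ idx) (sideP (F.P K) Mc ρ) ρ (K - n) 0))
      {HV : (BondIdx (cubeDomains (F.P K) (cornerP (F.P K) Mc ρ idx) (sideP (F.P K) Mc ρ) ρ (K - n) hk) → MatA N) →ₗ[ℂ] (PBond (F.P K) 0 → MatA N)}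
      (_ : ∀ (B' : BondIdx (cubeDomains (F.P K) (cornerP (F.P K) Mc ρ idx) (sideP (F.P K) Mc ρ) ρ (K - n) hk) → MatA N) (b : PBond (F.P K) 0),
        HV B' b = ∑ c, ((flatH (F.P K) (K - n) (cubeDomains (F.P K) (cornerP (F.P K) Mc ρ idx) (sideP (F.P K) Mc ρ) ρ (K - n) hk) (Pi.single c 1) b : ℝ) : ℂ) • B' c)
      -- the CANONICAL level boxes of the tower (four equation binders)
      {lo hi : ℕ → Pt (F.P K).d}
      (_ : lo 0 = fun i => ((F.P K).L : ℤ) * (sqLo (F.P K).L (cornerP (F.P K) Mc ρ idx) ρ (K - n) 1 i - 1))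
      (_ : hi 0 = fun i => ((F.P K).L : ℤ) * (sqHi (F.P K).L (cornerP (F.P K) Mc ρ idx) (sideP (F.P K) Mc ρ) ρ (K - n) 1 i + 1) + (((F.P K).L : ℤ) - 1))
      (_ : ∀ j, 1 ≤ j → lo j = sqLo (F.P K).L (cornerP (F.P K) Mc ρ idx) ρ (K - n) j - 1) (_ : ∀ j, 1 ≤ j → hi j = sqHi (F.P K).L (cornerP (F.P K) Mc ρ idx) (sideP (F.P K) Mc ρ) ρ (K - n) j + 1)
      -- the shear gauge `u♮`; the shift family, DOMINATED by the (r1) letter family, and its datum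
      (uL : GaugeTransf (F.P K) 0 (SU N))
      (lam : (j : ℕ) → Site (F.P K) j → MatA N)
      (_ : ∀ (j : ℕ) (y : Site (F.P K) j), ‖lam j y‖ ≤ ‖mlog (((((toMS uL j (castSite (lo j)))⁻¹ * toMS uL j y)⁻¹ : SU N)) : MatA N)‖)
      {X : BondIdx (cubeDomains (F.P K) (cornerP (F.P K) Mc ρ idx) (sideP (F.P K) Mc ρ) ρ (K - n) hk) → MatA N}
      (_ : ∀ c : BondIdx (cubeDomains (F.P K) (cornerP (F.P K) Mc ρ idx) (sideP (F.P K) Mc ρ) ρ (K - n) hk),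
        X c = LatticeFieldCalculus.grad (((F.P K).L : ℝ) ^ (K - n) / ((F.P K).L : ℝ) ^ (c.1.1 : ℕ)) (lam c.1.1) c.1.2)
      -- S3's gauge of `U` on the window, the (159)-splitting of `A − H_V X`
      {U : GaugeField (F.P K) 0 (SU N)} (u : GaugeTransf (F.P K) 0 (SU N)) {A A₁ A₂ A₃ : PBond (F.P K) 0 → MatA N} {t t₁ t₂ t₃ : ℝ}
      (_ : ∀ b ∈ (Sect2.regionOfSet (F.P K) (cover (F.P K) '' box (F.P K).L (cornerP (F.P K) Mc ρ idx) (sideP (F.P K) Mc ρ) (K - n))).bonds,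
        gaugeU (fun x => ιSU N (u x)) (fun b' => ιSU N (U b')) b = expI ((F.P K).eta (K - n)) (A b))
      (_ : ∀ b ∈ (Sect2.regionOfSet (F.P K) (cover (F.P K) '' box (F.P K).L (cornerP (F.P K) Mc ρ idx) (sideP (F.P K) Mc ρ) (K - n))).bonds, ‖A b‖ < t)
      (_ : ∀ q ∈ (Sect2.regionOfSet (F.P K) (cover (F.P K) '' box (F.P K).L (cornerP (F.P K) Mc ρ idx) (sideP (F.P K) Mc ρ) (K - n))).dpairs,
        ‖grad ((F.P K).eta (K - n)) q.2.1 (fun y => A ⟨y, q.2.2⟩) q.1‖ < t)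
      (_ : ∀ b, A b - HV X b = A₁ b + A₂ b - A₃ b)
      (_ : Letters10On (cover (F.P K) '' box (F.P K).L (cornerP (F.P K) Mc ρ idx) (sideP (F.P K) Mc ρ) (K - n)) ((F.P K).eta (K - n)) t₁ A₁)
      (_ : Letters10On (cover (F.P K) '' box (F.P K).L (cornerP (F.P K) Mc ρ idx) (sideP (F.P K) Mc ρ) (K - n)) ((F.P K).eta (K - n)) t₂ A₂)
      (_ : Letters10On (cover (F.P K) '' box (F.P K).L (cornerP (F.P K) Mc ρ idx) (sideP (F.P K) Mc ρ) (K - n)) ((F.P K).eta (K - n)) t₃ A₃)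
      -- ★ the Landau side of the shear: the (152) equation and letter on (cornerP (F.P K) Mc ρ idx) bond set containing the fine bonds of `□̃` (LOCATED-LANDAU-REGION), `0 ≤ t`, `η t ≤ 1`
      (_ : 0 ≤ t) (_ : (F.P K).eta (K - n) * t ≤ 1) {B : Set (PBond (F.P K) 0)}
      (_ : ∀ b ∈ B, gaugeU (fun x => ιSU N (u x)) (fun b' => ιSU N (U b')) b = expI ((F.P K).eta (K - n)) (A b)) (_ : ∀ b ∈ B, ‖A b‖ < t)
      (_ : ∀ b : PBond (F.P K) 0,
        b.src ∈ (castSite '' Set.Icc (tlo (F.P K).L (tLo (cornerP (F.P K) Mc ρ idx) ρ) (K - n - 0)) (thi (F.P K).L (tHi (cornerP (F.P K) Mc ρ idx) (sideP (F.P K) Mc ρ) ρ) (K - n - 0)) : Set (Site (F.P K) 0)) →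
        b.tgt ∈ (castSite '' Set.Icc (tlo (F.P K).L (tLo (cornerP (F.P K) Mc ρ idx) ρ) (K - n - 0)) (thi (F.P K).L (tHi (cornerP (F.P K) Mc ρ idx) (sideP (F.P K) Mc ρ) ρ) (K - n - 0)) : Set (Site (F.P K) 0)) → b ∈ B)
      -- ★ `(((F.P K).L : ℝ) ^ 2 * ε)` with its ranges, fine regularity near `□̃`, the radial WLOG and the top letter of the representative `(U^{u})^{u♮}`
      {ε : ℝ} (_ : 0 < ε) (_ : (143 * (((((F.P K).d + 4 : ℕ) : ℝ)) ^ 2 / 4) ^ 2) * (((F.P K).L : ℝ) ^ 2 * ε) ≤ 1 / 3)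
      (_ : 2 * (((F.P K).L : ℝ) ^ 2 * ε) ≤ 2 * deltaSU (Fin N) / ((((F.P K).d + 4) * (F.P K).L : ℕ) : ℝ) ^ 2)
      -- ★ the token's (17) clause ONE LEVEL DOWN, on the top region of print's sequence
      (_ : PlaqSmallOn (Sect2.omegaPlaqsTop s.Ω (hullD (F.P K) M₁ 1 (s.Ω 1)) (K - n - 1)) (ε * (F.P K).eta (K - n - 1) ^ 2) U)
      {vk : ℝ} (_ : 0 ≤ vk)
      (_ : ∀ i < K - n, AxialGauge (radialContourData (F.P K) i (SU N)) (Averaging.iter (avOfRecord F N K) i (gaugeAct uL (gaugeAct u U))))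
      (_ : ∀ c : PBond (F.P K) (K - n),
        c.src ∈ (castSite '' Set.Icc (tlo (F.P K).L (tLo (cornerP (F.P K) Mc ρ idx) ρ) (K - n - (K - n))) (thi (F.P K).L (tHi (cornerP (F.P K) Mc ρ idx) (sideP (F.P K) Mc ρ) ρ) (K - n - (K - n))) : Set (Site (F.P K) (K - n))) →
        c.tgt ∈ (castSite '' Set.Icc (tlo (F.P K).L (tLo (cornerP (F.P K) Mc ρ idx) ρ) (K - n - (K - n))) (thi (F.P K).L (tHi (cornerP (F.P K) Mc ρ idx) (sideP (F.P K) Mc ρ) ρ) (K - n - (K - n))) : Set (Site (F.P K) (K - n))) →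
        dist1 (Averaging.iter (avOfRecord F N K) (K - n) (gaugeAct uL (gaugeAct u U)) c) ≤ vk)
      -- ★ ONE smallness on the AFFINE shear letter `2d((sideP (F.P K) Mc ρ)+4ρ+1)(4κ(((F.P K).L : ℝ) ^ 2 * ε) + v_k + 2t)`
      (_ : 2 * (((F.P K).d : ℝ) * ((((sideP (F.P K) Mc ρ) + 4 * ρ + 1 : ℕ) : ℝ) * (4 * ((((F.P K).d * ((F.P K).L - 1) + 1 : ℕ) : ℝ) * ((((F.P K).d - 1 : ℕ) : ℝ) * (((F.P K).L - 1 : ℕ) : ℝ)) + 7 * (((((F.P K).d + 2) * (F.P K).L : ℕ) : ℝ) ^ 2 / 4) + ((((F.P K).d + 1) * ((F.P K).L - 1) : ℕ) : ℝ) * ((((F.P K).d * ((F.P K).L - 1) + 1 : ℕ) : ℝ) * ((((F.P K).d - 1 : ℕ) : ℝ) * (((F.P K).L - 1 : ℕ) : ℝ)))) * (((F.P K).L : ℝ) ^ 2 * ε) + vk + 2 * t))) ≤ 1 / 2)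
      {tD : ℝ} (_ : 2 * C * B₃ * (4 * (2 * (((F.P K).d : ℝ) * ((((sideP (F.P K) Mc ρ) + 4 * ρ + 1 : ℕ) : ℝ) * (4 * ((((F.P K).d * ((F.P K).L - 1) + 1 : ℕ) : ℝ) * ((((F.P K).d - 1 : ℕ) : ℝ) * (((F.P K).L - 1 : ℕ) : ℝ)) + 7 * (((((F.P K).d + 2) * (F.P K).L : ℕ) : ℝ) ^ 2 / 4) + ((((F.P K).d + 1) * ((F.P K).L - 1) : ℕ) : ℝ) * ((((F.P K).d * ((F.P K).L - 1) + 1 : ℕ) : ℝ) * ((((F.P K).d - 1 : ℕ) : ℝ) * (((F.P K).L - 1 : ℕ) : ℝ)))) * (((F.P K).L : ℝ) ^ 2 * ε) + vk + 2 * t))))) < tD),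
      LocalGaugeSplitOn (cover (F.P K) '' box (F.P K).L (cornerP (F.P K) Mc ρ idx) (sideP (F.P K) Mc ρ) (K - n)) ((F.P K).eta (K - n)) t (t₁ + (t₂ + tD) + t₃) U := by
  obtain ⟨Mh₀, R₀, C, δ₀, δ₁, B₃, hC, hδ₀, hδ₁, hB₃, hmain⟩ := localGaugeSplitOn_of_gauge152_recordShearTildeTower_of_fine_cubeDomains_box F N
  refine ⟨Mh₀, R₀, C, δ₀, δ₁, B₃, hC, hδ₀, hδ₁, hB₃, ?_⟩
  intro n K hk1 hk' hk Mh R a' hMha hMh hR hsize Dfam kS M₁ hM₁ s hsep hnk Mc ρ Dw hfloor idx hdat hρ ha hM hper hRρ hLρ hinj HV hHV lo hi hlo0 hhi0 hloj hhij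
    uL lam hlam X hX U u A A₁ A₂ A₃ t t₁ t₂ t₃ he hA hdA h159 h₁ h₂ h₃ ht0 hηt B heB hAB hB ε hε hε3 hε2 h17 vk hvk hax htop hςaff tD htD
  obtain ⟨x, y, hx, hy, hxy⟩ := hdat
  have hρ0 : 0 < ρ := lt_of_lt_of_le (by have := F.hL11; omega) hLρ
  have hM1 : 1 ≤ sideP (F.P K) Mc ρ := by have := le_sideP (P := F.P K) Mc hρ0; omega
  have hα : 0 < ((F.P K).L : ℝ) ^ 2 * ε := by have := (F.P K).L_pos; positivity
  refine hmain n K hk1 hk' hk hMha hMh hR hsize hM1 hρ ha hM hper hRρ hLρ hinj hHV hlo0 hhi0 hloj hhij uL lam hlam hX u he hA hdA h159 h₁ h₂ h₃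
    ht0 hηt heB hAB hB hα hε3 hε2 ?_ hvk hax htop hςaff htD
  -- `h52`: the widened fine □̃ lies in the (17)-region one level down, and `ε·η_{K−n−1}² = L²ε·η_{K−n}²` (p642198)
  intro q hq
  obtain ⟨z, hz, hsrc⟩ := hq
  rw [← mul_eta_pred_sq (F.P K) ε hk1]
  exact h17 q (mem_omegaPlaqsTop_pred_of_mem_tildeTowerWide_zero hM₁ s hsep hρ0 hfloor hk1 hnk hx hy hxy hz hsrc)

end Summit.QuantumFields.YangMills.BalabanUVNodes.N07ShearLetterAtDatum

end
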